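import Literature.MathematicalPhysics.QuantumLattice.XYGaugeTwist
import Literature.MathematicalPhysics.QuantumLattice.XYTwistedOrderEngine
import HarnessLib

/-!
# Two admissible gauges with vanishing average, and the exhaustion of gauge twists by covariance

Trunk T-QLATTICE; consumes `XYGaugeTwist.lean` (star rule) and `XYTwistedOrderEngine.lean` (engine).
For the standing disproof of the crux `XYOrderOpennessLargeSpin` (stmt-HubbardSuperconductivity-13895):
the three gauges whose star rules refute the crux with ONE clause deleted (inversion, translation,
norm), and the lemma that the three clauses together force every gauge twist to be trivial.
Finite-dimensional algebra and cyclotomic sums; tagged folklore.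

## Contents (namespace `XYGaugeTwist`)

* `zero_rule_admissible`: the zero rule is admissible in every sense (degenerate sides).
* The commensurate LINEAR gauge `XYHelix.gauge θ⋆ L = q_L·x`: translation-invariant increments
  (`cexp_gauge_translate`), small increments (`smallIncr_gauge`), `Σ_x e^{iq_L·x} = 0` once the
  twist number is nonzero (`sum_cexpGauge_gauge_eq_zero`). It is ODD: killed by site inversion.
* The TENT gauge `tentGauge θ⋆ L x = θ_L · min(x₀.val, (-x₀).val)`, `θ_L = tentSlope θ⋆ L =
  2π m/(L/2)`, `m = ⌊(L/2)θ⋆/2π⌋`: EVEN (`tentGauge_neg`), `1`-Lipschitz profile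
  (`tentVal_add_one_le`), small increments (`smallIncr_tentGauge`), and on the torus `(ℤ/2k)²`
  with `1 ≤ m < k`: `Σ_x e^{iψ_x} = 0` exactly (`sum_cexpGauge_tent_eq_zero`, via
  `Σ_{a ∈ ℤ/2k} G(g a) = Σ_{v<k} G v + Σ_{v<k} G(k-v)` and `Σ_{v<k} ζ^v = 0`, `ζ = e^{2πi m/k}`).
  Its increments are NOT translation invariant: killed by translation covariance.
* The STAGGERED gauge `torusPhase L (halfMom L)`, `halfMom L = (L/2, L/2)` (increment `π` per
  bond): even modulo `2π` on even sides (`cexp_torusPhase_neg_of_add_self`, `halfMom_add_self`),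
  nonzero momentum (`halfMom_ne_zero`), `Σ_x e^{iψ_x} = 0` (`sum_cexpGauge_torusPhase_eq_zero`);
  its star rule turns the ferromagnet into the ANTIFERROMAGNET and violates only the norm clause.
* `cexp_incr_eq_one_of_covariant`, `wStar_eq_zero_of_covariant`: translation-invariant increments
  + even gauge ⇒ every increment is `±1`; with `|1 - cos δ| ≤ η < 2` it is `1` and `w⋆ ≡ 0`.

## Sources

* H. Tasaki (2020), §2.1–2.2 (rotations about the `3`-axis); standard cyclotomic identities
  (Mathlib `geom_sum_eq`, `Complex.exp_two_pi_mul_I_mul_div_eq_one_iff`).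
-/

noncomputable section

open Matrix Complex Finset
open scoped ComplexOrder
open Literature.MathematicalPhysics.QuantumLattice Literature.Probability.LatticeModels

namespace Literature.MathematicalPhysics.QuantumLattice

namespace XYGaugeTwist

/-! ### Admissible gauges -/

section Gauges

/-! #### Admissibility of the zero rule (degenerate sides) -/

/-- The zero rule is admissible in every sense. [folklore] -/
theorem zero_rule_admissible (n r : ℕ) (L : ℕ) [NeZero L] (x : TorusSite 2 L) :
    IsSupportedOn (0 : Op (TorusSite 2 L) (n + 1)) (torusBall x r) ∧
    (∃ hw : Matrix.IsHermitian (0 : Op (TorusSite 2 L) (n + 1)), ∀ i, |hw.eigenvalues i| ≤ 1) ∧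
    Commute (0 : Op (TorusSite 2 L) (n + 1)) (totalSpin n 2) := by
  refine ⟨⟨0, localOp_zero _⟩, ⟨isHermitian_zero, fun i => XYHelix.abs_eigenvalues_le_one _ ?_ ?_ i⟩,
    Commute.zero_left _⟩
  · rw [sub_zero]; exact PosSemidef.one
  · rw [add_zero]; exact PosSemidef.one

/-! ### The commensurate linear (helical) gauge -/

/-- The linear gauge has translation-invariant increments modulo `2π`. [folklore] -/
theorem cexp_gauge_translate (L : ℕ) [NeZero L] (q x y v : TorusSite 2 L) :
    Complex.exp (((torusPhase L q (x + v) - torusPhase L q (y + v) : ℝ) : ℂ) * I) =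
      Complex.exp (((torusPhase L q x - torusPhase L q y : ℝ) : ℂ) * I) := by
  have h1 := cexp_torusPhase_add_sub L q (y + v) (x - y)
  have h2 := cexp_torusPhase_add_sub L q y (x - y)
  rw [show y + v + (x - y) = x + v by abel] at h1
  rw [show y + (x - y) = x by abel] at h2
  rw [h1, h2]

/-- The linear gauge sums to zero once the twist number is nonzero: `Σ_x e^{i q_L·x} = 0`. [folklore] -/
theorem sum_cexpGauge_gauge_eq_zero (L : ℕ) [NeZero L] {θs : ℝ} (hθ : θs ≤ 1 / 2) (hθ' : 0 ≤ θs)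
    (hm : XYHelix.twistNum θs L ≠ 0) :
    ∑ x, cexpGauge L (XYHelix.gauge θs L) x = 0 := by
  have hq : XYHelix.twistMom θs L ≠ 0 := XYHelix.twistMom_ne_zero hθ hθ' L hm
  have h : ∀ x, cexpGauge L (XYHelix.gauge θs L) x = torusChar (XYHelix.twistMom θs L) x := by
    intro x
    rw [cexpGauge, XYHelix.gauge, ← Literature.MathematicalPhysics.QuantumLattice.torusChar_eq_exp]
    rfl
  simp_rw [h, sum_torusChar_right]
  rw [if_neg hq]

/-- Small increments of the linear gauge (both directions). [folklore] -/
theorem smallIncr_gauge (L : ℕ) [NeZero L] (hL : 2 ≤ L) {θs : ℝ} (hθ : θs ≤ 1 / 2)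
    (hθ' : 0 ≤ θs) (x : TorusSite 2 L) (i : Fin 2) :
    (|1 - Real.cos (XYHelix.gauge θs L (x + Pi.single i 1) - XYHelix.gauge θs L x)| ≤ θs ∧ |Real.sin (XYHelix.gauge θs L (x + Pi.single i 1) - XYHelix.gauge θs L x)| ≤ θs) ∧
      (|1 - Real.cos (XYHelix.gauge θs L (x - Pi.single i 1) - XYHelix.gauge θs L x)| ≤ θs ∧ |Real.sin (XYHelix.gauge θs L (x - Pi.single i 1) - XYHelix.gauge θs L x)| ≤ θs) := by
  have hp0 : 0 ≤ XYHelix.pitch θs L := XYHelix.pitch_nonneg θs L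
  have hp1 : XYHelix.pitch θs L ≤ θs := XYHelix.pitch_le L hθ'
  have h1 : θs ≤ 1 := by linarith
  have hsmall : (|1 - Real.cos (XYHelix.pitch θs L)| ≤ θs ∧ |Real.sin (XYHelix.pitch θs L)| ≤ θs) :=
    smallIncr_of_abs_le (by rw [abs_of_nonneg hp0]; exact hp1) h1
  have hsmall' : (|1 - Real.cos (-XYHelix.pitch θs L)| ≤ θs ∧ |Real.sin (-XYHelix.pitch θs L)| ≤ θs) :=
    smallIncr_of_abs_le (by rw [abs_neg, abs_of_nonneg hp0]; exact hp1) h1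
  constructor
  · exact smallIncr_congr (XYHelix.cexp_gauge_step L hθ hθ' hL x i) hsmall
  · refine smallIncr_congr ?_ hsmall'
    have h := XYHelix.cexp_gauge_step' L hθ hθ' hL (x - Pi.single i 1) i
    rw [sub_add_cancel] at h
    rw [h]
    push_cast
    ring_nf

end Gauges

/-! ### The tent (reflected-helix) gauge -/

section Tent

/-- Distance to `0` on the cycle `ℤ/Lℤ`: `g(a) = min(a.val, (-a).val)`. [folklore] -/
def tentVal {L : ℕ} (a : ZMod L) : ℕ := min a.val (-a).val

/-- `g` is even. [folklore] -/
theorem tentVal_neg {L : ℕ} (a : ZMod L) : tentVal (-a) = tentVal a := by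
  rw [tentVal, tentVal, neg_neg, min_comm]

/-- Closed form `g(a) = min(a.val, L - a.val)` (`L ≠ 0`). [folklore] -/
theorem tentVal_eq {L : ℕ} [NeZero L] (a : ZMod L) : tentVal a = min a.val (L - a.val) := by
  rw [tentVal, ZMod.neg_val]
  split_ifs with h
  · subst h; simp
  · rfl

/-- `g` is `1`-Lipschitz along the cycle (`L ≥ 2`). [folklore] -/
theorem tentVal_add_one_le {L : ℕ} [NeZero L] (hL : 2 ≤ L) (a : ZMod L) :
    tentVal (a + 1) ≤ tentVal a + 1 ∧ tentVal a ≤ tentVal (a + 1) + 1 := by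
  haveI : Fact (1 < L) := ⟨by omega⟩
  have hv : (a + 1).val = (a.val + 1) % L := by rw [ZMod.val_add, ZMod.val_one]
  have hlt : a.val < L := ZMod.val_lt a
  rw [tentVal_eq, tentVal_eq, hv]
  rcases Nat.lt_or_ge (a.val + 1) L with h | h
  · rw [Nat.mod_eq_of_lt h]; omega
  · have h' : a.val + 1 = L := by omega
    rw [h', Nat.mod_self]; omega

/-- Real form of the Lipschitz bound, forward step. [folklore] -/
theorem abs_tentVal_add_one_sub_le {L : ℕ} [NeZero L] (hL : 2 ≤ L) (a : ZMod L) :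
    |((tentVal (a + 1) : ℕ) : ℝ) - ((tentVal a : ℕ) : ℝ)| ≤ 1 := by
  obtain ⟨h1, h2⟩ := tentVal_add_one_le hL a
  rw [abs_le]
  constructor
  · have : ((tentVal a : ℕ) : ℝ) ≤ (tentVal (a + 1) : ℕ) + 1 := by exact_mod_cast h2
    linarith
  · have : ((tentVal (a + 1) : ℕ) : ℝ) ≤ (tentVal a : ℕ) + 1 := by exact_mod_cast h1
    linarith

/-- Real form of the Lipschitz bound, backward step. [folklore] -/
theorem abs_tentVal_sub_one_sub_le {L : ℕ} [NeZero L] (hL : 2 ≤ L) (a : ZMod L) :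
    |((tentVal (a - 1) : ℕ) : ℝ) - ((tentVal a : ℕ) : ℝ)| ≤ 1 := by
  have h := abs_tentVal_add_one_sub_le hL (a - 1)
  rw [sub_add_cancel] at h
  rwa [abs_sub_comm]

/-- The tent slope `θ_L = 2π m / (L/2)`, `m = ⌊(L/2) θ⋆ / 2π⌋` (the commensurate pitch of the
half-side). [folklore] -/
def tentSlope (θs : ℝ) (L : ℕ) : ℝ := XYHelix.pitch θs (L / 2)

/-- The tent gauge `ψ(x) = θ_L · g(x₀)`: even in `x`, climbing by `±θ_L` per bond along `e₀`,
constant along `e₁`. [folklore] -/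
def tentGauge (θs : ℝ) (L : ℕ) (x : TorusSite 2 L) : ℝ := tentSlope θs L * ((tentVal (x 0) : ℕ) : ℝ)

/-- The tent gauge is EVEN. [folklore] -/
theorem tentGauge_neg (θs : ℝ) (L : ℕ) (x : TorusSite 2 L) :
    tentGauge θs L (-x) = tentGauge θs L x := by
  rw [tentGauge, tentGauge, Pi.neg_apply, tentVal_neg]

/-- `0 ≤ θ_L ≤ θ⋆`. [folklore] -/
theorem tentSlope_bounds {θs : ℝ} (hθ' : 0 ≤ θs) (L : ℕ) (hL : 2 ≤ L) :
    0 ≤ tentSlope θs L ∧ tentSlope θs L ≤ θs := by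
  haveI : NeZero (L / 2) := ⟨by omega⟩
  exact ⟨XYHelix.pitch_nonneg θs _, XYHelix.pitch_le (L / 2) hθ'⟩

/-- Small increments of the tent gauge (both directions, both axes). [folklore] -/
theorem smallIncr_tentGauge (L : ℕ) [NeZero L] (hL : 2 ≤ L) {θs : ℝ} (hθ : θs ≤ 1 / 2)
    (hθ' : 0 ≤ θs) (x : TorusSite 2 L) (i : Fin 2) :
    (|1 - Real.cos (tentGauge θs L (x + Pi.single i 1) - tentGauge θs L x)| ≤ θs ∧ |Real.sin (tentGauge θs L (x + Pi.single i 1) - tentGauge θs L x)| ≤ θs) ∧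
      (|1 - Real.cos (tentGauge θs L (x - Pi.single i 1) - tentGauge θs L x)| ≤ θs ∧ |Real.sin (tentGauge θs L (x - Pi.single i 1) - tentGauge θs L x)| ≤ θs) := by
  obtain ⟨hs0, hs1⟩ := tentSlope_bounds hθ' L hL
  have h1 : θs ≤ 1 := by linarith
  have key : ∀ b : ZMod L, |((tentVal b : ℕ) : ℝ) - ((tentVal (x 0) : ℕ) : ℝ)| ≤ 1 →
      (|1 - Real.cos (tentSlope θs L * ((tentVal b : ℕ) : ℝ) - tentSlope θs L * ((tentVal (x 0) : ℕ) : ℝ))| ≤ θs ∧ |Real.sin (tentSlope θs L * ((tentVal b : ℕ) : ℝ) - tentSlope θs L * ((tentVal (x 0) : ℕ) : ℝ))| ≤ θs) := by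
    intro b hb
    refine smallIncr_of_abs_le ?_ h1
    rw [← mul_sub, abs_mul, abs_of_nonneg hs0]
    calc tentSlope θs L * |((tentVal b : ℕ) : ℝ) - ((tentVal (x 0) : ℕ) : ℝ)|
        ≤ tentSlope θs L * 1 := mul_le_mul_of_nonneg_left hb hs0
      _ ≤ θs := by linarith
  simp only [tentGauge, Pi.add_apply, Pi.sub_apply]
  by_cases hi : i = 0
  · subst hi
    rw [Pi.single_eq_same]
    exact ⟨key _ (abs_tentVal_add_one_sub_le hL (x 0)), key _ (abs_tentVal_sub_one_sub_le hL (x 0))⟩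
  · rw [Pi.single_eq_of_ne (Ne.symm hi), add_zero, sub_zero]
    have h0 : |((tentVal (x 0) : ℕ) : ℝ) - ((tentVal (x 0) : ℕ) : ℝ)| ≤ 1 := by simp
    exact ⟨key _ h0, key _ h0⟩

/-! ##### The tent gauge averages to zero -/

/-- Sums over `ℤ/Mℤ` through the canonical representative. [folklore] -/
theorem sum_zmod_val {M : ℕ} [NeZero M] {β : Type*} [AddCommMonoid β] (h : ℕ → β) :
    ∑ a : ZMod M, h a.val = ∑ v ∈ Finset.range M, h v := by
  have himg : (Finset.univ : Finset (ZMod M)).image ZMod.val = Finset.range M := by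
    ext v
    simp only [Finset.mem_image, Finset.mem_univ, true_and, Finset.mem_range]
    constructor
    · rintro ⟨a, rfl⟩; exact ZMod.val_lt a
    · intro hv; exact ⟨(v : ZMod M), by rw [ZMod.val_natCast, Nat.mod_eq_of_lt hv]⟩
  rw [← himg, Finset.sum_image fun a _ b _ hab => ZMod.val_injective M hab]

/-- The tent profile seen through representatives on an even cycle `2k`:
`Σ_{a ∈ ℤ/2k} G(g(a)) = Σ_{v<k} G(v) + Σ_{v<k} G(k - v)`. [folklore] -/
theorem sum_tentVal_even {k : ℕ} (hk : 1 ≤ k) [NeZero (2 * k)] {β : Type*} [AddCommMonoid β]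
    (G : ℕ → β) :
    ∑ a : ZMod (2 * k), G (tentVal a) =
      ∑ v ∈ Finset.range k, G v + ∑ v ∈ Finset.range k, G (k - v) := by
  have h1 : ∑ a : ZMod (2 * k), G (tentVal a) = ∑ a : ZMod (2 * k), G (min a.val (2 * k - a.val)) := by
    refine Finset.sum_congr rfl fun a _ => ?_
    rw [tentVal_eq]
  rw [h1, sum_zmod_val (fun v => G (min v (2 * k - v))), two_mul, Finset.sum_range_add]
  congr 1
  · refine Finset.sum_congr rfl fun v hv => ?_
    rw [Finset.mem_range] at hv
    congr 1; omega
  · refine Finset.sum_congr rfl fun v hv => ?_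
    rw [Finset.mem_range] at hv
    congr 1; omega

/-- A primitive-type root of unity: `ζ = e^{2πi m/k}` with `0 < m < k` has `ζ^k = 1`, `ζ ≠ 1`,
hence `Σ_{v<k} ζ^v = 0`. [folklore] -/
theorem geom_sum_root_eq_zero {k m : ℕ} (hm0 : 0 < m) (hmk : m < k) :
    ∑ v ∈ Finset.range k, Complex.exp (((2 * Real.pi * m / k : ℝ) : ℂ) * I) ^ v = 0 := by
  set ζ := Complex.exp (((2 * Real.pi * m / k : ℝ) : ℂ) * I) with hζ
  have hk0 : k ≠ 0 := by omega
  have hform : (((2 * Real.pi * m / k : ℝ) : ℂ) * I) = 2 * Real.pi * I * m / k := by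
    push_cast; ring
  have hζk : ζ ^ k = 1 := by
    rw [hζ, ← Complex.exp_nat_mul, hform]
    have : (k : ℂ) * (2 * Real.pi * I * m / k) = m * (2 * Real.pi * I) := by
      field_simp
    rw [this]
    exact Complex.exp_nat_mul_two_pi_mul_I m
  have hζ1 : ζ ≠ 1 := by
    rw [hζ, hform]
    intro h
    have hdvd := (Complex.exp_two_pi_mul_I_mul_div_eq_one_iff hk0).1 h
    exact absurd (Nat.le_of_dvd hm0 hdvd) (by omega)
  rw [geom_sum_eq hζ1, hζk, sub_self, zero_div]

/-- **The tent gauge averages to zero** on an even cycle with nonzero twist number: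
`Σ_{a ∈ ℤ/2k} e^{iθ g(a)} = 0`, `θ = 2πm/k`, `1 ≤ m < k`. [folklore] -/
theorem sum_cexp_tent_eq_zero {k : ℕ} (hk : 1 ≤ k) [NeZero (2 * k)] {m : ℕ} (hm0 : 0 < m)
    (hmk : m < k) :
    ∑ a : ZMod (2 * k), Complex.exp ((((2 * Real.pi * m / k) * ((tentVal a : ℕ) : ℝ) : ℝ) : ℂ) * I) = 0 := by
  set ζ := Complex.exp (((2 * Real.pi * m / k : ℝ) : ℂ) * I) with hζ
  have hG : ∀ j : ℕ, Complex.exp ((((2 * Real.pi * m / k) * (j : ℝ) : ℝ) : ℂ) * I) = ζ ^ j := by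
    intro j
    rw [hζ, ← Complex.exp_nat_mul]
    congr 1
    push_cast
    ring
  have hk0 : k ≠ 0 := by omega
  have hζk : ζ ^ k = 1 := by
    have := hG k
    rw [← this]
    have e : ((((2 * Real.pi * m / k) * (k : ℝ) : ℝ)) : ℂ) * I = m * (2 * Real.pi * I) := by
      have hk' : (k : ℝ) ≠ 0 := by exact_mod_cast hk0
      push_cast
      field_simp
    rw [e]
    exact Complex.exp_nat_mul_two_pi_mul_I m
  rw [sum_tentVal_even hk (fun j => Complex.exp ((((2 * Real.pi * m / k) * (j : ℝ) : ℝ) : ℂ) * I))]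
  simp only [hG]
  have h2 : ∑ v ∈ Finset.range k, ζ ^ (k - v) = ζ * ∑ v ∈ Finset.range k, ζ ^ v := by
    have e : ∑ v ∈ Finset.range k, ζ ^ (k - v) =
        ∑ v ∈ Finset.range k, (fun j => ζ ^ (j + 1)) (k - 1 - v) := by
      refine Finset.sum_congr rfl fun v hv => ?_
      rw [Finset.mem_range] at hv
      simp only
      rw [show k - 1 - v + 1 = k - v by omega]
    rw [e, Finset.sum_range_reflect (fun j => ζ ^ (j + 1)) k, Finset.mul_sum]
    refine Finset.sum_congr rfl fun v _ => ?_
    rw [pow_succ, mul_comm]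
  rw [h2, geom_sum_root_eq_zero hm0 hmk, mul_zero, add_zero]

/-- Sums of functions of the first coordinate factor through the cycle. [folklore] -/
theorem sum_torus_fst_eq_zero {L : ℕ} [NeZero L] (F : ZMod L → ℂ) (hF : ∑ a, F a = 0) :
    ∑ x : TorusSite 2 L, F (x 0) = 0 := by
  rw [← Equiv.sum_comp (finTwoArrowEquiv (ZMod L)).symm (fun x : TorusSite 2 L => F (x 0))]
  simp only [finTwoArrowEquiv_symm_apply, Matrix.cons_val_zero]
  rw [Fintype.sum_prod_type, Finset.sum_comm]
  simp [hF]

/-- **The tent gauge sums to zero on the torus** `(ℤ/2k)²` once `1 ≤ m < k`. [folklore] -/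
theorem sum_cexpGauge_tent_eq_zero {k : ℕ} (hk : 1 ≤ k) [NeZero (2 * k)] {θs : ℝ}
    (hm0 : 0 < XYHelix.twistNum θs k) (hmk : XYHelix.twistNum θs k < k) :
    ∑ x : TorusSite 2 (2 * k), cexpGauge (2 * k) (tentGauge θs (2 * k)) x = 0 := by
  have hdiv : 2 * k / 2 = k := by omega
  have h := sum_cexp_tent_eq_zero hk hm0 hmk
  refine sum_torus_fst_eq_zero (fun a => cexpGauge (2 * k) (tentGauge θs (2 * k)) (fun _ => a)) ?_
  convert h using 2 with a
  simp only [cexpGauge, tentGauge, tentSlope, hdiv, XYHelix.pitch]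

end Tent

/-! ### The staggered gauge (sublattice rotation) -/

section Staggered

/-- Any linear gauge `torusPhase L q` sums to zero when `q ≠ 0` (character orthogonality). [folklore] -/
theorem sum_cexpGauge_torusPhase_eq_zero (L : ℕ) [NeZero L] {q : TorusSite 2 L} (hq : q ≠ 0) :
    ∑ x, cexpGauge L (torusPhase L q) x = 0 := by
  have h : ∀ x, cexpGauge L (torusPhase L q) x = torusChar q x := by
    intro x
    rw [cexpGauge, ← Literature.MathematicalPhysics.QuantumLattice.torusChar_eq_exp]
    rfl
  simp_rw [h, sum_torusChar_right]
  rw [if_neg hq]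

/-- A self-opposite momentum has a REAL character: `2q = 0 ⇒ conj χ_q = χ_q`. [folklore] -/
theorem conj_torusChar_of_add_self {L : ℕ} [NeZero L] {q : TorusSite 2 L} (hq : q + q = 0)
    (a : TorusSite 2 L) : (starRingEnd ℂ) (torusChar q a) = torusChar q a := by
  have hneg : -q = q := neg_eq_iff_add_eq_zero.2 hq
  have h := torusChar_sub_left (0 : TorusSite 2 L) q a
  rw [zero_sub, torusChar_zero_left, one_mul, hneg] at h
  exact h.symm

/-- `e^{i(ψ_u - ψ_v)} = χ_q(u) conj χ_q(v)` for the linear gauge `ψ = torusPhase L q`. [folklore] -/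
theorem cexp_torusPhase_sub (L : ℕ) [NeZero L] (q u v : TorusSite 2 L) :
    Complex.exp (((torusPhase L q u - torusPhase L q v : ℝ) : ℂ) * I) =
      torusChar q u * (starRingEnd ℂ) (torusChar q v) := by
  rw [show ((torusPhase L q u - torusPhase L q v : ℝ) : ℂ) * I =
      (torusPhase L q u : ℂ) * I + (((-torusPhase L q v : ℝ)) : ℂ) * I by push_cast; ring,
    Complex.exp_add, ← star_cexp_mul_I,
    ← Literature.MathematicalPhysics.QuantumLattice.torusChar_eq_exp,
    ← Literature.MathematicalPhysics.QuantumLattice.torusChar_eq_exp, Complex.star_def]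
  rfl

/-- The linear gauge of a self-opposite momentum is EVEN modulo `2π`. [folklore] -/
theorem cexp_torusPhase_neg_of_add_self (L : ℕ) [NeZero L] {q : TorusSite 2 L} (hq : q + q = 0)
    (a b : TorusSite 2 L) :
    Complex.exp (((torusPhase L q (-a) - torusPhase L q (-b) : ℝ) : ℂ) * I) =
      Complex.exp (((torusPhase L q a - torusPhase L q b : ℝ) : ℂ) * I) := by
  rw [cexp_torusPhase_sub, cexp_torusPhase_sub, torusChar_neg_right, torusChar_neg_right,
    conj_torusChar_of_add_self hq, conj_torusChar_of_add_self hq, conj_torusChar_of_add_self hq]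

/-- The half momentum `q_L = (L/2, L/2)` (the staggered momentum `(π, π)` on even sides). [folklore] -/
def halfMom (L : ℕ) : TorusSite 2 L := fun _ => ((L / 2 : ℕ) : ZMod L)

/-- On even sides `q_L` is self-opposite: `q_L + q_L = 0`. [folklore] -/
theorem halfMom_add_self {L : ℕ} (hL : Even L) : halfMom L + halfMom L = 0 := by
  funext i
  simp only [Pi.add_apply, Pi.zero_apply, halfMom]
  rw [← Nat.cast_add, show L / 2 + L / 2 = L by obtain ⟨m, hm⟩ := hL; omega, ZMod.natCast_self]

/-- On the even side `2k ≥ 2` the half momentum is the nonzero staggered momentum. [folklore] -/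
theorem halfMom_ne_zero {k : ℕ} (hk : 1 ≤ k) : halfMom (2 * k) ≠ 0 := by
  intro h
  have h0 := congrFun h 0
  simp only [halfMom, Pi.zero_apply, Nat.mul_div_cancel_left k two_pos] at h0
  have hdvd := (ZMod.natCast_eq_zero_iff k (2 * k)).1 h0
  have := Nat.le_of_dvd (by omega) hdvd
  omega

end Staggered

/-! ### Exhaustion: the three clauses together kill every gauge twist -/

section Exhaustion

variable (L : ℕ) [NeZero L] (n : ℕ)

omit [NeZero L] in
/-- **Joint covariance forces trivial increments.** If a gauge has translation-invariant
increments modulo `2π` AND is even, then every bond increment `u = e^{i(ψ_{x+eᵢ}-ψ_x)}` satisfies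
`u = conj u`, i.e. `u = ±1`; if moreover the increments are `η`-small with `η < 2`
(the norm clause), then `u = 1`. [folklore] -/
theorem cexp_incr_eq_one_of_covariant (ψ : TorusSite 2 L → ℝ)
    (hT : ∀ x y v : TorusSite 2 L,
      Complex.exp (((ψ (x + v) - ψ (y + v) : ℝ) : ℂ) * I) =
        Complex.exp (((ψ x - ψ y : ℝ) : ℂ) * I))
    (hE : ∀ x, ψ (-x) = ψ x) {η : ℝ} (hη : η < 2)
    (hS : ∀ (x : TorusSite 2 L) (i : Fin 2), (|1 - Real.cos (ψ (x + Pi.single i 1) - ψ x)| ≤ η ∧ |Real.sin (ψ (x + Pi.single i 1) - ψ x)| ≤ η))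
    (x : TorusSite 2 L) (i : Fin 2) :
    Complex.exp (((ψ (x + Pi.single i 1) - ψ x : ℝ) : ℂ) * I) = 1 := by
  set e : TorusSite 2 L := Pi.single i 1 with he
  set u : ℂ := Complex.exp (((ψ e - ψ 0 : ℝ) : ℂ) * I) with hu
  -- every forward increment equals `u`
  have hfw : ∀ y : TorusSite 2 L, Complex.exp (((ψ (y + e) - ψ y : ℝ) : ℂ) * I) = u := by
    intro y
    have h := hT e 0 y
    rw [zero_add, add_comm] at h
    exact h
  -- evenness at the bond `(-e, 0)`: `u = conj u`
  have hback : Complex.exp (((ψ 0 - ψ e : ℝ) : ℂ) * I) = u := by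
    have h := hfw (-e)
    rw [neg_add_cancel, hE] at h
    exact h
  have hconj : star u = u := by
    conv_lhs => rw [hu]
    rw [star_cexp_mul_I, ← hback]
    congr 1
    push_cast
    ring
  -- `u` is real and unimodular with `|1 - Re u| ≤ η < 2`, hence `u = 1`
  have hre : (u.im : ℝ) = 0 := by
    have := congrArg Complex.im hconj
    rw [Complex.star_def, Complex.conj_im] at this
    linarith
  have hcos : Real.cos (ψ e - ψ 0) = u.re := by
    rw [hu, Complex.exp_ofReal_mul_I_re]
  have hsin : Real.sin (ψ e - ψ 0) = u.im := by
    rw [hu, Complex.exp_ofReal_mul_I_im]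
  have hsin0 : Real.sin (ψ e - ψ 0) = 0 := by rw [hsin, hre]
  have hcos1 : Real.cos (ψ e - ψ 0) = 1 := by
    have hsq := Real.sin_sq_add_cos_sq (ψ e - ψ 0)
    rw [hsin0] at hsq
    have hc : Real.cos (ψ e - ψ 0) = 1 ∨ Real.cos (ψ e - ψ 0) = -1 := by
      have : (Real.cos (ψ e - ψ 0) - 1) * (Real.cos (ψ e - ψ 0) + 1) = 0 := by nlinarith
      rcases mul_eq_zero.1 this with h | h
      · left; linarith
      · right; linarith
    rcases hc with h | h
    · exact h
    · exfalso
      have hsm := (hS 0 i).1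
      rw [zero_add, ← he, h] at hsm
      norm_num at hsm
      linarith
  have hu1 : u = 1 := by
    apply Complex.ext
    · rw [← hcos, hcos1]; simp
    · rw [hre]; simp
  rw [hfw x, hu1]

/-- **Exhaustion of the gauge attack by the crux's own clauses**: a star-gauge rule that is both
translation covariant (translation-invariant increments) and site-inversion covariant (even gauge)
and obeys the norm clause (small increments) is identically ZERO. The helical witness (odd,
linear gauge) is killed by inversion, the tent witness (even gauge) by translation; nothing of
this family survives both. [folklore] -/
theorem wStar_eq_zero_of_covariant (ψ : TorusSite 2 L → ℝ)
    (hT : ∀ x y v : TorusSite 2 L,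
      Complex.exp (((ψ (x + v) - ψ (y + v) : ℝ) : ℂ) * I) =
        Complex.exp (((ψ x - ψ y : ℝ) : ℂ) * I))
    (hE : ∀ x, ψ (-x) = ψ x) {η : ℝ} (hη : η < 2)
    (hS : ∀ (x : TorusSite 2 L) (i : Fin 2), (|1 - Real.cos (ψ (x + Pi.single i 1) - ψ x)| ≤ η ∧ |Real.sin (ψ (x + Pi.single i 1) - ψ x)| ≤ η))
    (ε : ℝ) (x : TorusSite 2 L) : wStar L n ψ ε x = 0 := by
  have hfw : ∀ (y : TorusSite 2 L) (i : Fin 2),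
      twistBond n (ψ (y + Pi.single i 1) - ψ y) y (y + Pi.single i 1) = 0 := by
    intro y i
    rw [twistBond_congr n (δ' := 0) (by
      rw [cexp_incr_eq_one_of_covariant L ψ hT hE hη hS y i]; push_cast; simp), twistBond_zero]
  have hbw : ∀ (y : TorusSite 2 L) (i : Fin 2),
      twistBond n (ψ (y - Pi.single i 1) - ψ y) y (y - Pi.single i 1) = 0 := by
    intro y i
    have h := cexp_incr_eq_one_of_covariant L ψ hT hE hη hS (y - Pi.single i 1) i
    rw [sub_add_cancel] at h
    have h' : Complex.exp (((ψ (y - Pi.single i 1) - ψ y : ℝ) : ℂ) * I) = 1 := by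
      have := congrArg star h
      rw [star_cexp_mul_I, star_one] at this
      rw [← this]
      congr 1; push_cast; ring
    rw [twistBond_congr n (δ' := 0) (by rw [h']; push_cast; simp), twistBond_zero]
  rw [wStar]
  simp [hfw, hbw]

end Exhaustion

end XYGaugeTwist

end Literature.MathematicalPhysics.QuantumLattice
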